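import Literature.Analysis.FluidPDE.DeRosaThreeStages
import Literature.Analysis.FluidPDE.OnsagerBDSVPerturbationAssembly
import Literature.Analysis.FluidPDE.OnsagerBDSVFlowJacobian
import Literature.Analysis.FluidPDE.OnsagerBDSVRhoQDeriv
import Literature.Analysis.FluidPDE.FracLaplacianSpaceTime
import HarnessLib

/-!
# De Rosa's perturbation stage (§§5.3–5.5 of De Rosa 2019): architecture of the proof

L. De Rosa, *Infinitely many Leray–Hopf solutions for the fractional Navier–Stokes equations*,
Comm. PDE 44 (2019) 335–365 = arXiv:1801.10235. The perturbation stage of his convex-integration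
scheme (the named fact `DeRosa.perturbationStage`, `DeRosaThreeStages.lean`) is, in the words of
the source, "the construction of [BDLSV2017]" (Buckmaster–De Lellis–Székelyhidi–Vicol, CPAM 72
(2019), §§5–6) run for the fractional Navier–Stokes–Reynolds system (NSR): the same Mikado flows,
cut-offs, backward flows, perturbation `w_{q+1} = w_o + w_c` (§5.4) and Euler stress `R̊^E_{q+1}`
((5.39), "the definition of `R̊^E_{q+1}` is the same as in [BDLSV2017]"), plus a *dissipative
stress* `R̊^D_{q+1} = νℛ(-Δ)^γ w_{q+1}` ((5.40)), with Prop. 5.11 (= BDSV Cor. 5.8), Prop. 5.12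
(= BDSV Prop. 6.2: "does not involve the different structure of the Navier–Stokes equations"),
Prop. 5.13 (`‖R̊^E‖₀` "can be found in [BDLSV2017]" = BDSV Prop. 6.1; `‖R̊^D‖₀` via Thm. 7.1 and
Prop. 8.2) and the new pressure (5.41) `p_{q+1} = p̄_q - ∑ᵢ ρ_{q,i} + ρ_q`.

This file fixes the ARCHITECTURE of the tree's proof of `DeRosa.perturbationStage`, reusing the
honest construction of `OnsagerBDSVPerturbation.lean` (`BDSV.perturbation`, `BDSV.newVelocity`,
`BDSV.newPressure`, `BDSV.newStress`) verbatim: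

* `DeRosa.TripleRegularity`, `DeRosa.CoreHypotheses` — the part of BDSV's standing hypotheses
  `BDSV.PerturbationHypotheses` that the estimates of BDSV §§5–6 actually use. In the tree's
  proofs of Cor. 5.8, Props. 6.1–6.2 (files `OnsagerBDSV*`) the Euler–Reynolds system of the input
  enters only through the joint smoothness of `(v̄_q, p̄_q, R̊̄_q)`, `div v̄_q = 0`, the symmetry and
  trace-freeness of `R̊̄_q`, and the energy balance bound of Lemma 5.4 (5.18)
  `|d/dt ∫|v̄_q|²| ≤ 6 (C_in δ_{q+1} ℓ^α)(C_in δ_q^{1/2} λ_q)` — which De Rosa re-proves for (NSR)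
  in Lemma 5.9 (the bound `‖∂ₜρ_q‖₀ ≲ δ_{q+1}δ_q^{1/2}λ_q`, proof on p. 15: "`|d/dt∫|v̄_q|²| ≤ 2|∫∇v̄_q·R̊̄_q| + 2ν∫|(-Δ)^{γ/2}v̄_q|² ≲ …`",
  using a spatial Hölder bound of `v̄_q` above `γ` and Cor. 7.2). `DeRosa.CoreHypotheses` is
  `BDSV.PerturbationHypotheses` with the Euler–Reynolds field replaced by these consequences (same
  parameters, same field names), so that BDSV's estimates hold — with the same proofs — under it;
  `DeRosa.CoreHypotheses.ofBDSV` records that it is indeed weaker.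
* `DeRosa.NSRHypotheses` — the standing hypotheses of De Rosa's perturbation stage (the inputs
  of `DeRosa.perturbationStage` for a trace-free stress).
* `DeRosa.dissipativeStress` ((5.40)) and `DeRosa.newStress` ((5.38) `R̊_{q+1} = R̊^E + R̊^D`).
* The five PARTS of the proof as parametrised statements (internal decomposition, each proved in
  a sibling file): `DeRosa.incrementPart` (Prop. 5.11 = Cor. 5.8 under `CoreHypotheses`),
  `DeRosa.eulerStressPart` (Prop. 5.13 for `R̊^E` = Prop. 6.1), `DeRosa.energyPart` (Prop. 5.12 =
  Prop. 6.2), `DeRosa.dissipativePart` (Prop. 5.13 for `R̊^D`), `DeRosa.nsrPart` (the (NSR) system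
  for the new triple, §5.5), and, as the first hypothesis of the assembly, PART 0 (Lemma 5.9, bound on `∂ₜρ_q`: the NSR inputs
  satisfy `CoreHypotheses` with the input constant `DeRosa.coreConst C_in`, for `a` large).
* PROVED here: the trace normalisation of an NSR triple (`R̊ = R - (tr R/3)Id`, the trace moved
  into the pressure — `Torus.IsFracNSReynoldsOn` does not impose `tr R = 0`), the time-zero
  formula for `w_{q+1}(·,0)` (§5.4: "the dependence of `w_{q+1}(·,0)` on the function `e(t)` is
  only through the value `e(0)`"), and the ASSEMBLY
  `DeRosa.perturbationStage_of_parts : (part 0) → incrementPart → nsrPart → eulerStressPart →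
  dissipativePart → energyPart → DeRosa.perturbationStage` (Mikado flows, cut-offs and backward
  flows being the tree's `BDSV.mikado_exists_holds`, `BDSV.cutoffs_exist_holds`,
  `BDSV.backwardFlow_exists_holds`).

## References

* L. De Rosa, Comm. PDE 44 (2019) 335–365 = arXiv:1801.10235, §5.3 (energy gap, (5.19)–(5.21),
  Lemmas 5.6, 5.8, 5.9 with the proof of the bound on `∂ₜρ_q` on p. 15 of the arXiv text), §5.4
  (Lemma 5.10, (5.37), the curl form of `w_{q+1}`, time zero), §5.5 ((5.38)–(5.41), Props. 5.11–5.13), §7 (Thm. 7.1, Cor. 7.2), §8 (Prop. 8.2).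
  [`Derosa2018`]
* T. Buckmaster, C. De Lellis, L. Székelyhidi Jr., V. Vicol, CPAM 72 (2019) 229–274 =
  arXiv:1701.08678, §2.6, §5 (Lemma 5.4 (5.18)), Cor. 5.8, §5.4, Props. 6.1–6.2.
  [`BuckmasterEtAl2018`]
-/

open MeasureTheory Set
open scoped NNReal ENNReal ContDiff Matrix Matrix.Norms.Elementwise InnerProductSpace

noncomputable section

namespace Literature.Analysis.FluidPDE

namespace DeRosa

open BDSV FunctionSpaces FunctionSpaces.Torus

/-- The flat three-torus `𝕋³ = (ℝ/ℤ)³`, local notation. -/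
local notation "𝕋³" => UnitAddTorus (Fin 3)

/-- Euclidean `ℝ³`, local notation. -/
local notation "ℝ³" => EuclideanSpace ℝ (Fin 3)

/-- Real `3 × 3` matrices, local notation. -/
local notation "𝕄" => Matrix (Fin 3) (Fin 3) ℝ

/-! ## The hypotheses structures -/

section Hypotheses

/-- **What the perturbation estimates use of the system solved by the input triple**: joint
smoothness of `(v, p, R)` on `S × 𝕋³`, `div v = 0`, and a symmetric trace-free stress — the
fields of `Torus.IsEulerReynoldsOn` other than the momentum equation and the pressure
normalisation (BDSV §§5–6 use nothing else of the Euler–Reynolds system except the energy balance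
of Lemma 5.4, recorded separately in `DeRosa.CoreHypotheses.energy_rate`; De Rosa §§5.3–5.5 use
the same of (NSR)). [cite: Derosa2018, §5.3 (the inputs of the perturbation step)] -/
structure TripleRegularity (S : Set ℝ) (v : ℝ → 𝕋³ → ℝ³) (p : ℝ → 𝕋³ → ℝ)
    (R : ℝ → 𝕋³ → Fin 3 → ℝ³) : Prop where
  /-- The velocity is jointly smooth on `S × 𝕋³`. -/
  smooth_velocity : Torus.IsSmoothSpaceTimeOn S v
  /-- The pressure is jointly smooth on `S × 𝕋³`. -/
  smooth_pressure : Torus.IsSmoothSpaceTimeOn S p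
  /-- The stress is jointly smooth on `S × 𝕋³`. -/
  smooth_stress : Torus.IsSmoothSpaceTimeOn S R
  /-- `div v(t) = 0`. -/
  divFree : ∀ t ∈ S, IsDivFree (v t)
  /-- The stress is symmetric. -/
  symm : ∀ t ∈ S, ∀ x, ∀ i j : Fin 3, R t x i j = R t x j i
  /-- The stress is trace free. -/
  traceFree : ∀ t ∈ S, ∀ x, ∑ i, R t x i i = 0

/-- An Euler–Reynolds triple has the regularity package. [folklore] -/
theorem TripleRegularity.ofEulerReynolds {S : Set ℝ} {v : ℝ → 𝕋³ → ℝ³} {p : ℝ → 𝕋³ → ℝ}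
    {R : ℝ → 𝕋³ → Fin 3 → ℝ³} (h : Torus.IsEulerReynoldsOn S v p R) : TripleRegularity S v p R :=
  ⟨h.smooth_velocity, h.smooth_pressure, h.smooth_stress, h.divFree, h.symm, h.traceFree⟩

/-- A solution of (NSR) with trace-free stress has the regularity package. [folklore] -/
theorem TripleRegularity.ofFracNSReynolds {S : Set ℝ} {γ ν : ℝ} {v : ℝ → 𝕋³ → ℝ³}
    {p : ℝ → 𝕋³ → ℝ} {R : ℝ → 𝕋³ → Fin 3 → ℝ³} (h : Torus.IsFracNSReynoldsOn S γ ν v p R)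
    (htr : ∀ t ∈ S, ∀ x, ∑ i, R t x i i = 0) : TripleRegularity S v p R :=
  ⟨h.smooth_velocity, h.smooth_pressure, h.smooth_stress, h.divFree, h.symm, htr⟩

/-- **The core standing hypotheses of the perturbation step** at stage `q`, for the parameters
`P = (β, α, a, b)`, the setting `S = (T, e, q, v̄_q, p̄_q, R̊̄_q)`, `N̄` derivatives and constants
`C_in, C₀`: exactly `BDSV.PerturbationHypotheses` (`T > 0`; `e` normalised (2.1); (2.17)
`supp R̊̄_q ⊂ ⋃ₙ Iₙ × 𝕋³`; `‖v̄_q‖₀ ≤ C₀`; (2.19)–(2.21) = De Rosa (5.15)–(5.17) for `N ≤ N̄`; the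
energy gap (5.2) = De Rosa §5.3) EXCEPT that the Euler–Reynolds system is replaced by the
regularity package `DeRosa.TripleRegularity` together with the one consequence of the equations
used by the estimates, the energy-balance bound of BDSV Lemma 5.4 (5.18) / De Rosa Lemma 5.9
(proof of the bound on `∂ₜρ_q`): `|d/dt ∫|v̄_q|²| ≤ 6 (C_in δ_{q+1} ℓ^α)(C_in δ_q^{1/2} λ_q)` on `[0,T]` (one-sided derivative
within `[0,T]`; for Euler–Reynolds this is `|2∫∇v̄_q : R̊̄_q|` bounded through (2.19)|₀, (2.20)|₀;
for (NSR) De Rosa absorbs the extra dissipation `2ν∫|(-Δ)^{γ/2}v̄_q|²` into the same scale,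
part 0 of `DeRosa.perturbationStage_of_parts`). The field is named `eulerReynolds` so that the tree's BDSV proofs, which only
project `.smooth_velocity`, `.smooth_pressure`, `.smooth_stress`, `.divFree`, `.symm`, `.traceFree`
out of it, apply verbatim. [cite: Derosa2018, §5.3 Lemma 5.9 (bound on ∂ₜρ_q, proof p. 15); BDSV Lemma 5.4 (5.18)] -/
structure CoreHypotheses (P : Params) (S : Setting) (Nbar : ℕ) (Cin C₀ : ℝ) : Prop where
  /-- `0 < T`. -/
  pos_T : 0 < S.T
  /-- `e` is a normalised energy profile on `[0,T]`. -/
  profile : IsNormalisedProfile S.T S.e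
  /-- `(v̄_q, p̄_q, R̊̄_q)` is jointly smooth, `div v̄_q = 0`, `R̊̄_q` symmetric and trace free. -/
  eulerReynolds : TripleRegularity (Icc 0 S.T) S.vbar S.pbar S.Rbar
  /-- (2.17) `supp R̊̄_q ⊂ ⋃ₙ Iₙ × 𝕋³`. -/
  stress_support : SupportedOnGlueIntervals S.T (glueScale P.β P.α P.a P.b S.q) S.Rbar
  /-- `‖v̄_q‖₀ ≤ C₀`. -/
  velocity_sup : SupLE S.T S.vbar C₀
  /-- (2.19) `‖v̄_q‖_{1+N} ≤ C_in δ_q^{1/2} λ_q ℓ^{-N}` for `N ≤ N̄`. -/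
  velocity : ∀ N : ℕ, N ≤ Nbar → HolderSupLE S.T S.vbar (N + 1) 0
    (Cin * (Real.sqrt (amp P.β P.a P.b S.q) * freq P.a P.b S.q *
      mollScale P.β P.α P.a P.b S.q ^ (-(N : ℝ))))
  /-- (2.20) `‖R̊̄_q‖_{N+α} ≤ C_in δ_{q+1} ℓ^{-N+α}` for `N ≤ N̄`. -/
  stress : ∀ N : ℕ, N ≤ Nbar → HolderSupLE S.T S.Rbar N (Real.toNNReal P.α)
    (Cin * (amp P.β P.a P.b (S.q + 1) * mollScale P.β P.α P.a P.b S.q ^ (-(N : ℝ) + P.α)))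
  /-- (2.21) `‖(∂ₜ + v̄_q·∇) R̊̄_q‖_{N+α} ≤ C_in δ_{q+1} δ_q^{1/2} λ_q ℓ^{-N-α}` for `N ≤ N̄`. -/
  transport : ∀ N : ℕ, N ≤ Nbar →
    HolderSupLE S.T (advectiveDeriv S.T S.vbar S.Rbar) N (Real.toNNReal P.α)
      (Cin * (amp P.β P.a P.b (S.q + 1) * Real.sqrt (amp P.β P.a P.b S.q) * freq P.a P.b S.q *
        mollScale P.β P.α P.a P.b S.q ^ (-(N : ℝ) - P.α)))
  /-- (5.2) `δ_{q+1}/(2λ_q^α) ≤ e(t) - ∫ |v̄_q|² ≤ 2δ_{q+1}` on `[0,T]`. -/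
  energy_gap : ∀ t ∈ Icc 0 S.T,
    amp P.β P.a P.b (S.q + 1) * freq P.a P.b S.q ^ (-P.α) / 2 ≤ S.e t - ∫ x, ‖S.vbar t x‖ ^ 2 ∧
      S.e t - ∫ x, ‖S.vbar t x‖ ^ 2 ≤ 2 * amp P.β P.a P.b (S.q + 1)
  /-- BDSV (5.18) / De Rosa Lemma 5.9: `|d/dt ∫|v̄_q|²| ≤ 6 (C_in δ_{q+1} ℓ^α)(C_in δ_q^{1/2} λ_q)` on `[0,T]`. -/
  energy_rate : ∀ t ∈ Icc 0 S.T,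
    |derivWithin (fun s => ∫ x, ‖S.vbar s x‖ ^ 2) (Icc 0 S.T) t| ≤
      6 * (Cin * (amp P.β P.a P.b (S.q + 1) * mollScale P.β P.α P.a P.b S.q ^ P.α)) *
        (Cin * (Real.sqrt (amp P.β P.a P.b S.q) * freq P.a P.b S.q))

/-- The core hypotheses with `N̄` derivatives imply those with fewer derivatives. [folklore] -/
theorem CoreHypotheses.of_le {P : Params} {S : Setting} {Nbar Nbar' : ℕ} {Cin C₀ : ℝ}
    (H : CoreHypotheses P S Nbar Cin C₀) (h : Nbar' ≤ Nbar) : CoreHypotheses P S Nbar' Cin C₀ where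
  pos_T := H.pos_T
  profile := H.profile
  eulerReynolds := H.eulerReynolds
  stress_support := H.stress_support
  velocity_sup := H.velocity_sup
  velocity N hN := H.velocity N (hN.trans h)
  stress N hN := H.stress N (hN.trans h)
  transport N hN := H.transport N (hN.trans h)
  energy_gap := H.energy_gap
  energy_rate := H.energy_rate

/-- **BDSV's standing hypotheses imply the core hypotheses** (for `C_in ≥ 0`, `a ≥ 1`): the energy
balance of the Euler–Reynolds system, `d/dt∫|v̄_q|² = -2∫∑ⱼ⟪R̊̄_q^{(j)}, ∂ⱼv̄_q⟫`
(`Torus.IsEulerReynoldsOn.hasDerivWithinAt_energy`), bounded through (2.19)|₀ and (2.20)|₀ as in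
the proof of Lemma 5.4 (5.18). [cite: BuckmasterEtAl2018, Lemma 5.4 (5.18)] -/
theorem CoreHypotheses.ofBDSV {P : Params} {S : Setting} {Nbar : ℕ} {Cin C₀ : ℝ}
    (H : PerturbationHypotheses P S Nbar Cin C₀) (hCin : 0 ≤ Cin) (ha : 1 ≤ P.a) :
    CoreHypotheses P S Nbar Cin C₀ where
  pos_T := H.pos_T
  profile := H.profile
  eulerReynolds := TripleRegularity.ofEulerReynolds H.eulerReynolds
  stress_support := H.stress_support
  velocity_sup := H.velocity_sup
  velocity := H.velocity
  stress := H.stress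
  transport := H.transport
  energy_gap := H.energy_gap
  energy_rate t ht := by
    set BR : ℝ := Cin * (amp P.β P.a P.b (S.q + 1) * mollScale P.β P.α P.a P.b S.q ^ P.α) with hBR
    set Bv : ℝ := Cin * (Real.sqrt (amp P.β P.a P.b S.q) * freq P.a P.b S.q) with hBv
    have hBR0 : 0 ≤ BR :=
      mul_nonneg hCin (mul_nonneg (amp_pos ha _).le (Real.rpow_nonneg (mollScale_pos ha _).le _))
    have hBv0 : 0 ≤ Bv := mul_nonneg hCin (mul_nonneg (Real.sqrt_nonneg _) (freq_pos ha _).le)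
    have hR : ∀ x (j : Fin 3), ‖S.Rbar t x j‖ ≤ BR := by
      intro x j
      have hRt := H.stress 0 (Nat.zero_le _) t ht
      simp only [Nat.cast_zero, neg_zero, zero_add] at hRt
      exact (norm_le_pi_norm _ j).trans (norm_le_of_eContDiffHolderNorm_zero_le hBR0 hRt x)
    have hDv : ∀ x (j : Fin 3), ‖Torus.partialDeriv j (S.vbar t) x‖ ≤ Bv := by
      intro x j
      have hv := H.velocity 0 (Nat.zero_le _) t ht
      simp only [Nat.cast_zero, neg_zero, Real.rpow_zero, mul_one] at hv
      exact norm_partialDeriv_le_of_eContDiffHolderNorm_le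
        ((H.eulerReynolds.smooth_velocity.isSmooth_slice ht).isContDiff (by simp)) hBv0 hv j x
    have hrate := Torus.abs_energyRate_le (v := S.vbar) (R := S.Rbar) (t := t) hBR0 hR hDv
    rw [Fintype.card_fin] at hrate
    have hE := H.eulerReynolds.hasDerivWithinAt_energy H.pos_T ht
    rw [hE.derivWithin (uniqueDiffOn_Icc H.pos_T t ht)]
    calc |(-2 : ℝ) * ∫ x, ∑ j, ⟪S.Rbar t x j, Torus.partialDeriv j (S.vbar t) x⟫_ℝ|
        ≤ 2 * (3 : ℕ) * BR * Bv := hrate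
      _ = 6 * BR * Bv := by push_cast; ring

/-- **The standing hypotheses of De Rosa's perturbation stage** (§5.3) at stage `q`: the setting
`S = (T, e, q, v̄_q, p̄_q, R̊̄_q)` is a smooth solution of (NSR) with exponent `γ` and viscosity `ν`
on `[0,T] × 𝕋³` with trace-free stress supported on the glue intervals, `‖v̄_q‖₀ ≤ C₀`,
(5.15)–(5.17) for `N ≤ N̄`, the spatial Hölder bound `[v̄_q(t)]_θ ≤ C_H` (used on p. 15 in the
proof of Lemma 5.9) and the energy gap of §5.3 — the hypotheses of `DeRosa.perturbationStage`, the
trace of the stress having been moved into the pressure. [cite: Derosa2018, §5.3] -/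
structure NSRHypotheses (P : Params) (γ ν : ℝ) (θ : ℝ≥0) (S : Setting) (Nbar : ℕ) (Cin C₀ : ℝ)
    (CH : ℝ≥0) : Prop where
  /-- `0 < T`. -/
  pos_T : 0 < S.T
  /-- `e` is a normalised energy profile on `[0,T]`. -/
  profile : IsNormalisedProfile S.T S.e
  /-- `(v̄_q, p̄_q, R̊̄_q)` solves (NSR) on `[0,T] × 𝕋³`. -/
  fracNSR : Torus.IsFracNSReynoldsOn (Icc 0 S.T) γ ν S.vbar S.pbar S.Rbar
  /-- The stress is trace free. -/
  traceFree : ∀ t ∈ Icc 0 S.T, ∀ x, ∑ i, S.Rbar t x i i = 0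
  /-- `supp R̊̄_q ⊂ ⋃ₙ Iₙ × 𝕋³`. -/
  stress_support : SupportedOnGlueIntervals S.T (glueScale P.β P.α P.a P.b S.q) S.Rbar
  /-- `‖v̄_q‖₀ ≤ C₀`. -/
  velocity_sup : SupLE S.T S.vbar C₀
  /-- (5.15) for `N ≤ N̄`. -/
  velocity : ∀ N : ℕ, N ≤ Nbar → HolderSupLE S.T S.vbar (N + 1) 0
    (Cin * (Real.sqrt (amp P.β P.a P.b S.q) * freq P.a P.b S.q *
      mollScale P.β P.α P.a P.b S.q ^ (-(N : ℝ))))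
  /-- (5.16) for `N ≤ N̄`. -/
  stress : ∀ N : ℕ, N ≤ Nbar → HolderSupLE S.T S.Rbar N (Real.toNNReal P.α)
    (Cin * (amp P.β P.a P.b (S.q + 1) * mollScale P.β P.α P.a P.b S.q ^ (-(N : ℝ) + P.α)))
  /-- (5.17) for `N ≤ N̄`. -/
  transport : ∀ N : ℕ, N ≤ Nbar →
    HolderSupLE S.T (advectiveDeriv S.T S.vbar S.Rbar) N (Real.toNNReal P.α)
      (Cin * (amp P.β P.a P.b (S.q + 1) * Real.sqrt (amp P.β P.a P.b S.q) * freq P.a P.b S.q *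
        mollScale P.β P.α P.a P.b S.q ^ (-(N : ℝ) - P.α)))
  /-- `[v̄_q(t)]_θ ≤ C_H` for `t ∈ [0,T]`. -/
  holder : ∀ t ∈ Icc 0 S.T, HolderWith CH θ (S.vbar t)
  /-- The energy gap of §5.3 on `[0,T]`. -/
  energy_gap : ∀ t ∈ Icc 0 S.T,
    amp P.β P.a P.b (S.q + 1) * freq P.a P.b S.q ^ (-P.α) / 2 ≤ S.e t - ∫ x, ‖S.vbar t x‖ ^ 2 ∧
      S.e t - ∫ x, ‖S.vbar t x‖ ^ 2 ≤ 2 * amp P.β P.a P.b (S.q + 1)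

end Hypotheses

/-! ## The dissipative stress (5.40) and the new stress (5.38) -/

section Construction

variable (P : Params) (γ ν : ℝ) (S : Setting)

/-- **The dissipative stress** `R̊^D_{q+1} = ν ℛ((-Δ)^γ w_{q+1})` ((5.40)), with the tree's
De Lellis–Székelyhidi antidivergence `Torus.antidivergence` and spectral fractional Laplacian
`Torus.fracLaplacian γ`, applied to the perturbation `w_{q+1} = BDSV.perturbation` (stored by
columns). [cite: Derosa2018, §5.5 (5.40)] -/
def dissipativeStress (𝔚 : MikadoDatum mikadoRadius) (η : ℕ → ℝ → 𝕋³ → ℝ) (D : ℕ → ℝ → 𝕋³ → ℝ³)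
    (t : ℝ) (x : 𝕋³) (j : Fin 3) : ℝ³ :=
  ν • Torus.antidivergence (Torus.fracLaplacian γ (BDSV.perturbation P S 𝔚 η D t)) x j

/-- **The new Reynolds stress** `R̊_{q+1} = R̊^E_{q+1} + R̊^D_{q+1}` ((5.38)), the Euler part
`R̊^E_{q+1} = ℛ(w·∇v̄_q + ∂ₜw + v̄_q·∇w + div(-R̄_q + w ⊗ w))` ((5.39)) being the tree's
`BDSV.newStress`. [cite: Derosa2018, §5.5 (5.38)–(5.40)] -/
def newStress (𝔚 : MikadoDatum mikadoRadius) (η : ℕ → ℝ → 𝕋³ → ℝ) (D : ℕ → ℝ → 𝕋³ → ℝ³)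
    (t : ℝ) (x : 𝕋³) (j : Fin 3) : ℝ³ :=
  BDSV.newStress P S 𝔚 η D t x j + dissipativeStress P γ ν S 𝔚 η D t x j

end Construction

/-! ## The parts of the proof -/

section Parts

/-- **Part 1, the velocity increment bound** (De Rosa Prop. 5.11, last display, = BDSV Cor. 5.8
(5.31) "`‖w_{q+1}‖₀ + λ_{q+1}^{-1}‖w_{q+1}‖₁ ≤ (M/2) δ_{q+1}^{1/2}`, where the constant `M` depends
solely on the constant `c₀`" and on the Mikado profile, Lemma 5.10 / (5.37)), for the perturbation
built from the Mikado datum `𝔚` and cut-offs with constants `(c₀, C_η)`, under the CORE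
hypotheses: the statement of `BDSV.incrementEstimate` with `BDSV.PerturbationHypotheses` replaced
by `DeRosa.CoreHypotheses` (and `M` allowed to depend on `C_η` as well, which the assembly fixes
first). [cite: Derosa2018, §5.5 Prop. 5.11 and §5.4 (5.37)] -/
def incrementPart (𝔚 : MikadoDatum mikadoRadius) (c₀ : ℝ) (Cη : ℕ → ℕ → ℝ) : Prop :=
  ∃ M : ℝ, 0 < M ∧
    ∀ β : ℝ, 0 < β → β < 1 / 3 → ∀ b : ℝ, 1 < b → b < (1 - β) / (2 * β) →
      ∃ α₀ : ℝ, 0 < α₀ ∧ ∀ α : ℝ, 0 < α → α < α₀ → ∃ Nbar : ℕ, ∀ Cin C₀ : ℝ,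
        ∃ a₀ : ℝ, 1 < a₀ ∧ ∀ a : ℝ, a₀ ≤ a → ∀ S : Setting,
          CoreHypotheses ⟨β, α, a, b⟩ S Nbar Cin C₀ →
            ∀ 𝒟 : PerturbationData ⟨β, α, a, b⟩ S c₀ Cη,
              VelocityIncrementBound (M / 2) β a b S.T S.q
                (BDSV.perturbation ⟨β, α, a, b⟩ S 𝔚 𝒟.cut.η 𝒟.D)

/-- **Part 2, the new triple solves (NSR)** (De Rosa §5.5: "with this definition one may verify
that `∂ₜv_{q+1} + div(v_{q+1} ⊗ v_{q+1}) + ∇p_{q+1} + ν(-Δ)^γ v_{q+1} = div R̊_{q+1}`,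
`div v_{q+1} = 0`, where the new pressure is defined by (5.41)"), for
`(v̄_q + w_{q+1}, p_{q+1}, R̊^E_{q+1} + R̊^D_{q+1})`, under the NSR hypotheses.
[cite: Derosa2018, §5.5 (5.38)–(5.41)] -/
def nsrPart (𝔚 : MikadoDatum mikadoRadius) (c₀ : ℝ) (Cη : ℕ → ℕ → ℝ) : Prop :=
  ∀ β : ℝ, 0 < β → β < 1 / 3 → ∀ b : ℝ, 1 < b → b < (1 - β) / (2 * β) →
    ∃ α₀ : ℝ, 0 < α₀ ∧ ∀ α : ℝ, 0 < α → α < α₀ →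
      ∃ a₀ : ℝ, 1 < a₀ ∧ ∀ a : ℝ, a₀ ≤ a → ∀ γ : ℝ, 0 < γ → ∀ ν : ℝ, 0 < ν →
        ∀ (θ CH : ℝ≥0) (Nbar : ℕ) (Cin C₀ : ℝ) (S : Setting),
          NSRHypotheses ⟨β, α, a, b⟩ γ ν θ S Nbar Cin C₀ CH →
            ∀ 𝒟 : PerturbationData ⟨β, α, a, b⟩ S c₀ Cη,
              Torus.IsFracNSReynoldsOn (Icc 0 S.T) γ ν (BDSV.newVelocity ⟨β, α, a, b⟩ S 𝔚 𝒟.cut.η 𝒟.D)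
                (BDSV.newPressure ⟨β, α, a, b⟩ S 𝒟.cut.η)
                (newStress ⟨β, α, a, b⟩ γ ν S 𝔚 𝒟.cut.η 𝒟.D)

/-- **Part 3, the Euler stress estimate** (De Rosa Prop. 5.13, first display of the proof:
"`‖R̊^E_{q+1}‖₀ ≲ δ_{q+1}^{1/2} δ_q^{1/2} λ_q λ_{q+1}^{-1+4α}` … it can be found in [BDLSV2017]" =
BDSV Prop. 6.1), under the CORE hypotheses: the statement of `BDSV.stressEstimate` with
`DeRosa.CoreHypotheses`. [cite: Derosa2018, §5.5 Prop. 5.13 (the term R̊^E)] -/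
def eulerStressPart (𝔚 : MikadoDatum mikadoRadius) (c₀ : ℝ) (Cη : ℕ → ℕ → ℝ) : Prop :=
  ∀ β : ℝ, 0 < β → β < 1 / 3 → ∀ b : ℝ, 1 < b → b < (1 - β) / (2 * β) →
    ∃ α₀ : ℝ, 0 < α₀ ∧ ∀ α : ℝ, 0 < α → α < α₀ → ∃ Nbar : ℕ, ∀ Cin C₀ : ℝ,
      ∃ C a₀ : ℝ, 1 < a₀ ∧ ∀ a : ℝ, a₀ ≤ a → ∀ S : Setting,
        CoreHypotheses ⟨β, α, a, b⟩ S Nbar Cin C₀ →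
          ∀ 𝒟 : PerturbationData ⟨β, α, a, b⟩ S c₀ Cη,
            SupLE S.T (BDSV.newStress ⟨β, α, a, b⟩ S 𝔚 𝒟.cut.η 𝒟.D)
              (C * (Real.sqrt (amp β a b (S.q + 1)) * Real.sqrt (amp β a b S.q) *
                freq a b S.q * freq a b (S.q + 1) ^ (-1 + 4 * α)))

/-- **Part 4, the dissipative stress estimate** (De Rosa Prop. 5.13, second half of the proof,
p. 17: "`ν < 1` and the two operators `ℛ` and `(-Δ)^γ` commute … using Theorem 7.1 and
interpolation … Proposition 8.2 … `‖R̊^D_{q+1}‖₀ ≲ δ_{q+1}^{1/2} λ_{q+1}^{γ-1+α} ≲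
δ_{q+1}^{1/2} δ_q^{1/2} λ_q λ_{q+1}^{-1+4α}`", the last step by the parameter inequality of the
closing remark, valid for `γ < β`, `b < (1-β)/(2β)`), under the CORE hypotheses (the estimate
involves only the perturbation), for `0 < γ < β` and `0 < ν < 1`.
[cite: Derosa2018, §5.5 Prop. 5.13 (the term R̊^D)] -/
def dissipativePart (𝔚 : MikadoDatum mikadoRadius) (c₀ : ℝ) (Cη : ℕ → ℕ → ℝ) : Prop :=
  ∀ β : ℝ, 0 < β → β < 1 / 3 → ∀ γ : ℝ, 0 < γ → γ < β → ∀ b : ℝ, 1 < b → b < (1 - β) / (2 * β) →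
    ∃ α₀ : ℝ, 0 < α₀ ∧ ∀ α : ℝ, 0 < α → α < α₀ → ∃ Nbar : ℕ, ∀ Cin C₀ : ℝ,
      ∃ C a₀ : ℝ, 1 < a₀ ∧ ∀ a : ℝ, a₀ ≤ a → ∀ ν : ℝ, 0 < ν → ν < 1 → ∀ S : Setting,
        CoreHypotheses ⟨β, α, a, b⟩ S Nbar Cin C₀ →
          ∀ 𝒟 : PerturbationData ⟨β, α, a, b⟩ S c₀ Cη,
            SupLE S.T (dissipativeStress ⟨β, α, a, b⟩ γ ν S 𝔚 𝒟.cut.η 𝒟.D)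
              (C * (Real.sqrt (amp β a b (S.q + 1)) * Real.sqrt (amp β a b S.q) *
                freq a b S.q * freq a b (S.q + 1) ^ (-1 + 4 * α)))

/-- **Part 5, the energy estimate** (De Rosa Prop. 5.12 = BDSV Prop. 6.2, "does not involve the
different structure of the Navier–Stokes equations with respect to the Euler ones"), under the
CORE hypotheses: the statement of `BDSV.energyEstimate` with `DeRosa.CoreHypotheses`.
[cite: Derosa2018, §5.5 Prop. 5.12] -/
def energyPart (𝔚 : MikadoDatum mikadoRadius) (c₀ : ℝ) (Cη : ℕ → ℕ → ℝ) : Prop :=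
  ∀ β : ℝ, 0 < β → β < 1 / 3 → ∀ b : ℝ, 1 < b → b < (1 - β) / (2 * β) →
    ∃ α₀ : ℝ, 0 < α₀ ∧ ∀ α : ℝ, 0 < α → α < α₀ → ∃ Nbar : ℕ, ∀ Cin C₀ : ℝ,
      ∃ C a₀ : ℝ, 1 < a₀ ∧ ∀ a : ℝ, a₀ ≤ a → ∀ S : Setting,
        CoreHypotheses ⟨β, α, a, b⟩ S Nbar Cin C₀ →
          ∀ 𝒟 : PerturbationData ⟨β, α, a, b⟩ S c₀ Cη,
            ∀ t ∈ Icc 0 S.T,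
              |S.e t - (∫ x, ‖BDSV.newVelocity ⟨β, α, a, b⟩ S 𝔚 𝒟.cut.η 𝒟.D t x‖ ^ 2) -
                  amp β a b (S.q + 2) / 2| ≤
                C * (Real.sqrt (amp β a b S.q) * Real.sqrt (amp β a b (S.q + 1)) *
                  freq a b S.q ^ (1 + 2 * α) * (freq a b (S.q + 1))⁻¹)

end Parts

/-- The constant with which the core hypotheses are derived from the NSR hypotheses with input
constant `C_in`: `C_in' = 2(|C_in| + 1)` (room for the dissipation in the bound on `∂ₜρ_q` of Lemma 5.9). [folklore] -/
def coreConst (Cin : ℝ) : ℝ := 2 * (|Cin| + 1)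

/-! **Part 0, the NSR inputs satisfy the core hypotheses** (De Rosa Lemma 5.9, proof of the bound on
`∂ₜρ_q`, p. 15: "`|d/dt∫|v̄_q|²| ≤ 2|∫∇v̄_q·R̊̄_q| + 2ν∫|(-Δ)^{γ/2}v̄_q|² ≲ δ_{q+1}δ_q^{1/2}λ_qℓ^α`", the
dissipation being bounded through the Hölder bound `[v̄_q]_θ`, `θ > γ`, and Cor. 7.2, and then
absorbed since `δ_{q+1}δ_q^{1/2}λ_qℓ^α → ∞`) is the first hypothesis of
`DeRosa.perturbationStage_of_parts` below, with the input constant `C_in` replaced by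
`DeRosa.coreConst C_in` and `a` beyond a threshold depending on everything before it. -/

/-! ## Sup-norm bookkeeping -/

section Norms

variable {F : Type*} [NormedAddCommGroup F] {T : ℝ} {f g : ℝ → 𝕋³ → F} {B B' : ℝ}

/-- `‖f + g‖₀ ≤ ‖f‖₀ + ‖g‖₀`. [folklore] -/
theorem _root_.Literature.Analysis.FluidPDE.BDSV.SupLE.add (hf : SupLE T f B) (hg : SupLE T g B') :
    SupLE T (fun t x => f t x + g t x) (B + B') := fun t ht x =>
  (norm_add_le _ _).trans (add_le_add (hf t ht x) (hg t ht x))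

end Norms

/-! ## Trace normalisation of an NSR triple -/

section TraceFree

/-- The trace-free part of a `2`-tensor on `ℝ³` stored by columns:
`R̊ e_j = R e_j - (tr R / 3) e_j`. [folklore] -/
def traceFreePart (R : Fin 3 → ℝ³) (j : Fin 3) : ℝ³ :=
  R j - ((∑ i, R i i) / 3) • EuclideanSpace.single j (1 : ℝ)

/-- Entries of the trace-free part: `R̊ᵢⱼ = Rᵢⱼ - (tr R/3) δᵢⱼ`. [folklore] -/
theorem traceFreePart_apply (R : Fin 3 → ℝ³) (i j : Fin 3) :
    traceFreePart R j i = R j i - ((∑ k, R k k) / 3) * (if i = j then 1 else 0) := by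
  simp [traceFreePart]

/-- The trace-free part is trace free. [folklore] -/
theorem trace_traceFreePart (R : Fin 3 → ℝ³) : ∑ i, traceFreePart R i i = 0 := by
  simp only [traceFreePart_apply, if_true]
  rw [Finset.sum_sub_distrib]
  simp only [mul_one, Finset.sum_const, Finset.card_univ, Fintype.card_fin, nsmul_eq_mul]
  push_cast
  ring

/-- The trace-free part of a symmetric tensor is symmetric. [folklore] -/
theorem traceFreePart_symm {R : Fin 3 → ℝ³} (hR : ∀ i j, R i j = R j i) (i j : Fin 3) :
    traceFreePart R i j = traceFreePart R j i := by
  rw [traceFreePart_apply, traceFreePart_apply, hR j i]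
  by_cases h : i = j
  · subst h; rfl
  · rw [if_neg (Ne.symm h), if_neg h]

/-- The trace-free part as a continuous linear map of `(ℝ³)³`. [folklore] -/
def traceFreePartCLM : (Fin 3 → ℝ³) →L[ℝ] (Fin 3 → ℝ³) :=
  LinearMap.toContinuousLinearMap
    { toFun := traceFreePart
      map_add' := fun R R' => by
        funext j
        simp only [traceFreePart, Pi.add_apply, PiLp.add_apply, Finset.sum_add_distrib, add_div, add_smul]
        abel
      map_smul' := fun c R => by
        funext j
        simp only [traceFreePart, Pi.smul_apply, PiLp.smul_apply, smul_eq_mul, RingHom.id_apply,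
          ← Finset.mul_sum, smul_sub, smul_smul]
        congr 1
        ring_nf }

/-- `traceFreePartCLM R = traceFreePart R`. [folklore] -/
@[simp] theorem traceFreePartCLM_apply (R : Fin 3 → ℝ³) : traceFreePartCLM R = traceFreePart R := rfl

/-- `‖R̊‖ ≤ 2‖R‖` (column-sup norm): `‖R̊ e_j‖ ≤ ‖R e_j‖ + |tr R|/3` and `|tr R| ≤ 3‖R‖`. [folklore] -/
theorem norm_traceFreePart_le (R : Fin 3 → ℝ³) : ‖traceFreePart R‖ ≤ 2 * ‖R‖ := by
  -- a coordinate of a vector of `ℝ³` is bounded by its norm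
  have abs_apply_le_norm : ∀ (v : ℝ³) (i : Fin 3), |v i| ≤ ‖v‖ := by
    intro v i
    rw [EuclideanSpace.norm_eq v]
    have hi : (v i) ^ 2 ≤ ∑ k, ‖v k‖ ^ 2 := by
      have : ‖v i‖ ^ 2 ≤ ∑ k, ‖v k‖ ^ 2 :=
        Finset.single_le_sum (f := fun k => ‖v k‖ ^ 2) (fun k _ => sq_nonneg _) (Finset.mem_univ i)
      simpa [Real.norm_eq_abs, sq_abs] using this
    calc |v i| = Real.sqrt ((v i) ^ 2) := (Real.sqrt_sq_eq_abs _).symm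
      _ ≤ Real.sqrt (∑ k, ‖v k‖ ^ 2) := Real.sqrt_le_sqrt hi
  have htr : |∑ i, R i i| ≤ 3 * ‖R‖ := by
    calc |∑ i, R i i| ≤ ∑ i, |R i i| := Finset.abs_sum_le_sum_abs _ _
      _ ≤ ∑ _i : Fin 3, ‖R‖ := Finset.sum_le_sum fun i _ =>
          (abs_apply_le_norm (R i) i).trans (norm_le_pi_norm R i)
      _ = 3 * ‖R‖ := by simp
  refine (pi_norm_le_iff_of_nonneg (by positivity)).2 fun j => ?_
  calc ‖traceFreePart R j‖ ≤ ‖R j‖ + ‖((∑ i, R i i) / 3) • EuclideanSpace.single j (1 : ℝ)‖ :=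
        norm_sub_le _ _
    _ = ‖R j‖ + |∑ i, R i i| / 3 := by
        rw [norm_smul, PiLp.norm_single, norm_one, mul_one, Real.norm_eq_abs, abs_div,
          abs_of_pos (by norm_num : (0 : ℝ) < 3)]
    _ ≤ ‖R‖ + 3 * ‖R‖ / 3 := add_le_add (norm_le_pi_norm R j) (by gcongr)
    _ = 2 * ‖R‖ := by ring

/-- `‖traceFreePartCLM‖ ≤ 2`. [folklore] -/
theorem norm_traceFreePartCLM_le : ‖traceFreePartCLM‖ ≤ 2 :=
  ContinuousLinearMap.opNorm_le_bound _ (by norm_num) fun R => norm_traceFreePart_le R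

/-- **Hölder bounds pass to the trace-free part** with a factor `2`: if `‖g‖_{N+r} ≤ B` then
`‖R̊ ∘ g‖_{N+r} ≤ 2B` (post-composition with a linear map of norm `≤ 2`). [folklore] -/
theorem eContDiffHolderNorm_traceFreePart_le {N : ℕ} {r : ℝ≥0} {g : 𝕋³ → Fin 3 → ℝ³}
    (hg : IsContDiff N g) {B : ℝ} (h : Torus.eContDiffHolderNorm N r g ≤ ENNReal.ofReal B) :
    Torus.eContDiffHolderNorm N r (fun x => traceFreePart (g x)) ≤ ENNReal.ofReal (2 * B) := by
  have h1 := Torus.eContDiffHolderNorm_clm_comp_le traceFreePartCLM hg r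
  simp only [traceFreePartCLM_apply] at h1
  refine h1.trans ?_
  by_cases hB : 0 ≤ B
  · rw [ENNReal.ofReal_mul zero_le_two]
    refine mul_le_mul' ?_ h
    rw [← ofReal_norm]
    exact ENNReal.ofReal_le_ofReal norm_traceFreePartCLM_le
  · push Not at hB
    have h0 : Torus.eContDiffHolderNorm N r g = 0 :=
      le_antisymm (h.trans (by rw [ENNReal.ofReal_of_nonpos hB.le])) bot_le
    rw [h0, mul_zero]
    exact bot_le

variable {T γ ν : ℝ} {v : ℝ → 𝕋³ → ℝ³} {p : ℝ → 𝕋³ → ℝ} {R : ℝ → 𝕋³ → Fin 3 → ℝ³}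

/-- The trace of a jointly smooth tensor field is jointly smooth. [folklore] -/
theorem isSmoothSpaceTimeOn_trace {S : Set ℝ} (hR : Torus.IsSmoothSpaceTimeOn S R) :
    Torus.IsSmoothSpaceTimeOn S (fun t x => ∑ i, R t x i i) :=
  Torus.IsSmoothSpaceTimeOn.sum fun i _ =>
    (hR.clm_comp (ContinuousLinearMap.proj i)).clm_comp (EuclideanSpace.proj i)

/-- **Moving the trace of the stress into the pressure**: if `(v, p, R)` solves (NSR) on
`[0,T] × 𝕋³` then so does `(v, p - tr R/3, R̊)`, `R̊ = R - (tr R/3)Id` (since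
`div((tr R/3) Id) = ∇(tr R/3)`); the new stress is symmetric and trace free. (`Torus.IsFracNSReynoldsOn`
asks only for a symmetric stress; the scheme's estimates use `tr R̊̄_q = 0`.) [folklore] -/
theorem _root_.Literature.Analysis.FluidPDE.Torus.IsFracNSReynoldsOn.normaliseTrace
    (h : Torus.IsFracNSReynoldsOn (Icc 0 T) γ ν v p R) :
    Torus.IsFracNSReynoldsOn (Icc 0 T) γ ν v (fun t x => p t x - (∑ i, R t x i i) / 3)
      (fun t x => traceFreePart (R t x)) where
  smooth_velocity := h.smooth_velocity
  smooth_pressure :=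
    have hθ : Torus.IsSmoothSpaceTimeOn (Icc 0 T) (fun t x => (∑ i, R t x i i) / 3) :=
      ContDiffOn.div_const (isSmoothSpaceTimeOn_trace h.smooth_stress) 3
    h.smooth_pressure.sub hθ
  smooth_stress := h.smooth_stress.clm_comp traceFreePartCLM
  momentum t ht x := by
    have hRt : IsSmooth (R t) := h.smooth_stress.isSmooth_slice ht
    have hpt : IsSmooth (p t) := h.smooth_pressure.isSmooth_slice ht
    have hθt : IsSmooth (fun y => (∑ i, R t y i i) / 3) :=
      ((isSmoothSpaceTimeOn_trace h.smooth_stress).isSmooth_slice ht).div_const 3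
    have hE : IsSmooth (fun (y : 𝕋³) (j : Fin 3) => ((∑ i, R t y i i) / 3) • EuclideanSpace.single j (1 : ℝ)) :=
      hθt.smul' (isSmooth_const _)
    have hpθ : IsSmooth (fun y => p t y - (∑ i, R t y i i) / 3) := hpt.sub hθt
    -- the pressure gradient
    have e1 : gradient (fun y => p t y - (∑ i, R t y i i) / 3) x =
        gradient (p t) x - gradient (fun y => (∑ i, R t y i i) / 3) x := by
      rw [gradient_eq_sum_partialDeriv hpθ.isContDiff_one,
        gradient_eq_sum_partialDeriv hpt.isContDiff_one, gradient_eq_sum_partialDeriv hθt.isContDiff_one,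
        ← Finset.sum_sub_distrib]
      refine Finset.sum_congr rfl fun k _ => ?_
      rw [← sub_smul, Torus.partialDeriv_sub_at hpt.isContDiff_one hθt.isContDiff_one]
    -- the divergence of the trace-free part
    have e2 : Torus.tensorDivergence (fun y => traceFreePart (R t y)) x =
        Torus.tensorDivergence (R t) x - gradient (fun y => (∑ i, R t y i i) / 3) x := by
      have : (fun y => traceFreePart (R t y)) =
          fun y j => R t y j - ((∑ i, R t y i i) / 3) • EuclideanSpace.single j (1 : ℝ) := rfl
      rw [this, tensorDivergence_sub hRt hE, tensorDivergence_smul_single hθt]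
    rw [e1, e2, ← h.momentum t ht x]
    abel
  divFree := h.divFree
  symm t ht x i j := traceFreePart_symm (h.symm t ht x) i j

/-- The trace-free part is trace free, pointwise in space–time. [folklore] -/
theorem trace_traceFreePart_field (R : ℝ → 𝕋³ → Fin 3 → ℝ³) (t : ℝ) (x : 𝕋³) :
    ∑ i, traceFreePart (R t x) i i = 0 :=
  trace_traceFreePart _

/-- The support property passes to the trace-free part. [folklore] -/
theorem supportedOnGlueIntervals_traceFreePart {τ : ℝ} (hR : SupportedOnGlueIntervals T τ R) :
    SupportedOnGlueIntervals T τ (fun t x => traceFreePart (R t x)) := by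
  intro t ht hn x
  have h0 : R t x = 0 := hR t ht hn x
  show traceFreePartCLM (R t x) = 0
  rw [h0, map_zero]

/-- Hölder bounds of the stress pass to its trace-free part (factor `2`). [folklore] -/
theorem holderSupLE_traceFreePart (hR : Torus.IsSmoothSpaceTimeOn (Icc 0 T) R) {N : ℕ} {r : ℝ≥0}
    {B : ℝ} (h : HolderSupLE T R N r B) :
    HolderSupLE T (fun t x => traceFreePart (R t x)) N r (2 * B) := fun t ht =>
  eContDiffHolderNorm_traceFreePart_le ((hR.isSmooth_slice ht).isContDiff (by exact_mod_cast le_top))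
    (h t ht)

/-- Transport bounds of the stress pass to its trace-free part (factor `2`): the transport
derivative commutes with the linear map `R ↦ R̊`. [folklore] -/
theorem holderSupLE_advectiveDeriv_traceFreePart (hT : 0 < T)
    (hv : Torus.IsSmoothSpaceTimeOn (Icc 0 T) v) (hR : Torus.IsSmoothSpaceTimeOn (Icc 0 T) R)
    {N : ℕ} {r : ℝ≥0} {B : ℝ} (h : HolderSupLE T (advectiveDeriv T v R) N r B) :
    HolderSupLE T (advectiveDeriv T v (fun t x => traceFreePart (R t x))) N r (2 * B) := by
  intro t ht
  have heq : advectiveDeriv T v (fun t x => traceFreePart (R t x)) t =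
      fun x => traceFreePart (advectiveDeriv T v R t x) := by
    funext x
    exact advectiveDeriv_clm_apply hT hR traceFreePartCLM ht x
  rw [heq]
  have hsm : IsSmooth (advectiveDeriv T v R t) :=
    isSmooth_advectiveDeriv_slice hT hv hR ht
  exact eContDiffHolderNorm_traceFreePart_le (hsm.isContDiff (by exact_mod_cast le_top)) (h t ht)

end TraceFree

/-! ## Time zero: `w_{q+1}(·,0)` depends on `e` and `v̄_q` only through `e(0)`, `v̄_q(·,0)` -/

section TimeZero

variable (P : Params) (S : Setting) (𝔚 : MikadoDatum mikadoRadius) {η : ℕ → ℝ → 𝕋³ → ℝ}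
  {D : ℕ → ℝ → 𝕋³ → ℝ³}

/-- **The potential of the perturbation at time zero** (§5.4: "the dependence of `w_{q+1}(·,0)`
on the function `e(t)` is only trough the value `e(0)`"): if only the cut-off `η₀` is alive at
`t = 0` (property (iv)), the flow `Φ₀` is anchored at `t₀ = 0` (`Φ₀(·,0) = id`) and the stress
vanishes at `t = 0` (`0 ∉ ⋃ Iᵢ`), then `∇Φ₀ = Id`, `R̃_{q,0} = Id` at `t = 0` and
`Z(0,x) = η₀(0,x) (ρ_q(0)/∑ⱼ∫ηⱼ²(0))^{1/2} V(Id, n_{q+1} x)`. [cite: Derosa2018, §5.4 (time zero)] -/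
theorem potential_zero (hη : ∀ i, i ≠ 0 → ∀ x, η i 0 x = 0) (hD : ∀ x, D 0 0 x = 0)
    (hR : ∀ x, S.Rbar 0 x = 0) :
    BDSV.potential P S 𝔚 η D 0 = fun x =>
      (η 0 0 x * Real.sqrt (rhoQ P S 0 / etaMass P S η 0)) • 𝔚.V 1 (P.freqNat (S.q + 1) • x) := by
  have hD0 : D 0 0 = fun _ => 0 := funext hD
  have hgrad : ∀ x, gradPhi D 0 0 x = 1 := by
    intro x
    rw [gradPhi, hD0]
    have : (Matrix.of fun a b => Torus.partialDeriv b (fun _ : 𝕋³ => (0 : ℝ³)) x a) = 0 := by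
      ext a b
      simp [Torus.partialDeriv_const_apply]
    rw [this, add_zero]
  have htilde : ∀ x, tildeR P S η D 0 0 x = 1 := by
    intro x
    rw [tildeR, hgrad, hR x, ofCols_zero, smul_zero, sub_zero, Matrix.transpose_one, mul_one, mul_one]
  have hphi : ∀ x, phiPoint D 0 0 x = x := by
    intro x
    rw [phiPoint, hD x, proj_zero, add_zero]
  funext x
  unfold BDSV.potential
  have h0mem : 0 ∈ Finset.range (cutoffCount S.T (P.τ S.q)) := by
    rw [Finset.mem_range, cutoffCount]; omega
  rw [Finset.sum_eq_single_of_mem 0 h0mem fun i _ hi => by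
    rw [BDSV.sqrtRhoI, hη i hi x, zero_mul, zero_smul]]
  rw [BDSV.sqrtRhoI, hgrad, htilde, hphi, Matrix.transpose_one]
  congr 1
  have h1 : Matrix.toEuclideanLin (1 : 𝕄) (𝔚.V 1 (P.freqNat (S.q + 1) • x)) =
      WithLp.toLp 2 ((1 : 𝕄) *ᵥ WithLp.ofLp (𝔚.V 1 (P.freqNat (S.q + 1) • x))) := rfl
  rw [h1, Matrix.one_mulVec, WithLp.toLp_ofLp]

end TimeZero

/-! ## Assembly: the parts imply the perturbation stage -/

section Assembly

/-- The map `Ψ₃(e(0), v̄_q(·,0)) = v̄_q(·,0) + w_{q+1}(·,0)` of the time-zero clause: with the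
cut-offs `η` for `([0,T], τ_q)`, the Mikado potential `V` and `n = n_{q+1}`,
`Ψ₃(r, u) = u + n⁻¹ curl( η₀(0,·) ((r - δ_{q+2}/2 - ∫|u|²)/3 / ∑ⱼ∫ηⱼ²(0))^{1/2} V(Id, n ·) )`.
[cite: Derosa2018, §5.4 (time zero)] -/
def psiThree (P : Params) (T : ℝ) (q : ℕ) (𝔚 : MikadoDatum mikadoRadius) (η : ℕ → ℝ → 𝕋³ → ℝ)
    (r : ℝ) (u : 𝕋³ → ℝ³) : 𝕋³ → ℝ³ := fun x =>
  u x + ((P.freqNat (q + 1) : ℝ))⁻¹ •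
    BDSV.curl (fun y => (η 0 0 y * Real.sqrt (((r - amp P.β P.a P.b (q + 2) / 2 - ∫ z, ‖u z‖ ^ 2) / 3) /
      (∑ j ∈ Finset.range (cutoffCount T (P.τ q)), ∫ z, η j 0 z ^ 2))) • 𝔚.V 1 (P.freqNat (q + 1) • y)) x

/-- Six thresholds in `a` hold simultaneously beyond the largest one. [folklore] -/
private theorem le_of_max6_le {a a₀ a₁ a₂ a₃ a₄ a₅ : ℝ}
    (h : max (max a₀ (max a₁ a₂)) (max a₃ (max a₄ a₅)) ≤ a) :
    a₀ ≤ a ∧ a₁ ≤ a ∧ a₂ ≤ a ∧ a₃ ≤ a ∧ a₄ ≤ a ∧ a₅ ≤ a := by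
  simp only [max_le_iff] at h
  exact ⟨h.1.1, h.1.2.1, h.1.2.2, h.2.1, h.2.2.1, h.2.2.2⟩

/-- **Assembly of De Rosa's perturbation stage from its parts** (§5.3: "Starting with the
solution `(v̄_q, p̄_q, R̊̄_q)`, we then produce a new solution `(v_{q+1}, p_{q+1}, R̊_{q+1})` of the
Navier–Stokes–Reynolds system (NSR) with estimates (5.19)–(5.21), cf. Propositions 5.11, 5.12 and
5.13"; §5.5 (5.38) `R̊_{q+1} = R̊^E_{q+1} + R̊^D_{q+1}`): given that the NSR inputs satisfy the core
hypotheses (Lemma 5.9), the velocity increment bound (Prop. 5.11), the (NSR) system for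
the new triple (§5.5), the two stress estimates (Prop. 5.13) and the energy estimate
(Prop. 5.12) — each as a part universally quantified over the Mikado datum and the cut-off
constants — the stage `DeRosa.perturbationStage` follows: fix the Mikado flows of Lemma 5.6
(`BDSV.mikado_exists_holds`) and the cut-offs of Lemma 5.8 (`BDSV.cutoffs_exist_holds`), move the
trace of the input stress into the pressure, take the backward flows of `v̄_q`
(`BDSV.backwardFlow_exists_holds`), and read off (5.19), (5.20) (`‖R̊^E + R̊^D‖₀ ≤ ‖R̊^E‖₀ + ‖R̊^D‖₀`),
(5.21) and the time-zero identity (`DeRosa.potential_zero`). [cite: Derosa2018, §5.3 (5.19)–(5.21) and §5.5 (5.38)] -/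
theorem perturbationStage_of_parts
    (h₀ : ∀ β : ℝ, 0 < β → β < 1 / 3 → ∀ γ : ℝ, 0 < γ → γ < β → ∀ b : ℝ, 1 < b → b < (1 - β) / (2 * β) →
      ∀ θ : ℝ≥0, γ < (θ : ℝ) →
        ∃ α₀ : ℝ, 0 < α₀ ∧ ∀ α : ℝ, 0 < α → α < α₀ → ∀ (Nbar : ℕ) (Cin C₀ : ℝ) (CH : ℝ≥0),
          ∃ a₀ : ℝ, 1 < a₀ ∧ ∀ a : ℝ, a₀ ≤ a → ∀ ν : ℝ, 0 < ν → ν < 1 → ∀ S : Setting,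
            NSRHypotheses ⟨β, α, a, b⟩ γ ν θ S Nbar Cin C₀ CH →
              CoreHypotheses ⟨β, α, a, b⟩ S Nbar (coreConst Cin) C₀)
    (h₁ : ∀ (𝔚 : MikadoDatum mikadoRadius) (c₀ : ℝ), 0 < c₀ → ∀ Cη : ℕ → ℕ → ℝ, incrementPart 𝔚 c₀ Cη)
    (h₂ : ∀ (𝔚 : MikadoDatum mikadoRadius) (c₀ : ℝ), 0 < c₀ → ∀ Cη : ℕ → ℕ → ℝ, nsrPart 𝔚 c₀ Cη)
    (h₃ : ∀ (𝔚 : MikadoDatum mikadoRadius) (c₀ : ℝ), 0 < c₀ → ∀ Cη : ℕ → ℕ → ℝ, eulerStressPart 𝔚 c₀ Cη)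
    (h₄ : ∀ (𝔚 : MikadoDatum mikadoRadius) (c₀ : ℝ), 0 < c₀ → ∀ Cη : ℕ → ℕ → ℝ, dissipativePart 𝔚 c₀ Cη)
    (h₅ : ∀ (𝔚 : MikadoDatum mikadoRadius) (c₀ : ℝ), 0 < c₀ → ∀ Cη : ℕ → ℕ → ℝ, energyPart 𝔚 c₀ Cη) :
    perturbationStage := by
  obtain ⟨𝔚⟩ := mikado_exists_holds
  obtain ⟨c₀, hc₀, Cη, hcut⟩ := cutoffs_exist_holds
  obtain ⟨M, hM, h₁⟩ := h₁ 𝔚 c₀ hc₀ Cη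
  have h₂ := h₂ 𝔚 c₀ hc₀ Cη
  have h₃ := h₃ 𝔚 c₀ hc₀ Cη
  have h₄ := h₄ 𝔚 c₀ hc₀ Cη
  have h₅ := h₅ 𝔚 c₀ hc₀ Cη
  refine ⟨M, hM, ?_⟩
  intro β hβ hβ3 γ hγ hγβ b hb hbβ _hb43 θ hγθ _hθβ
  obtain ⟨α₀, hα₀, h₀⟩ := h₀ β hβ hβ3 γ hγ hγβ b hb hbβ θ hγθ
  obtain ⟨α₁, hα₁, h₁⟩ := h₁ β hβ hβ3 b hb hbβ
  obtain ⟨α₂, hα₂, h₂⟩ := h₂ β hβ hβ3 b hb hbβ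
  obtain ⟨α₃, hα₃, h₃⟩ := h₃ β hβ hβ3 b hb hbβ
  obtain ⟨α₄, hα₄, h₄⟩ := h₄ β hβ hβ3 γ hγ hγβ b hb hbβ
  obtain ⟨α₅, hα₅, h₅⟩ := h₅ β hβ hβ3 b hb hbβ
  refine ⟨min (min α₀ (min α₁ α₂)) (min α₃ (min α₄ α₅)),
    lt_min (lt_min hα₀ (lt_min hα₁ hα₂)) (lt_min hα₃ (lt_min hα₄ hα₅)), ?_⟩
  intro α hα hαlt
  simp only [lt_min_iff] at hαlt
  obtain ⟨⟨hα0, hα1, hα2⟩, hα3, hα4, hα5⟩ := hαlt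
  have h₀ := h₀ α hα hα0
  obtain ⟨N₁, h₁⟩ := h₁ α hα hα1
  obtain ⟨a₂, ha₂, h₂⟩ := h₂ α hα hα2
  obtain ⟨N₃, h₃⟩ := h₃ α hα hα3
  obtain ⟨N₄, h₄⟩ := h₄ α hα hα4
  obtain ⟨N₅, h₅⟩ := h₅ α hα hα5
  set Nbar : ℕ := max (max N₁ N₃) (max N₄ N₅) with hNbar
  refine ⟨Nbar, ?_⟩
  intro Cin C₀ CH
  -- the constants after the trace normalisation and after Lemma 5.9
  set Cin₁ : ℝ := 2 * |Cin| with hCin₁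
  set Cin₂ : ℝ := coreConst Cin₁ with hCin₂
  obtain ⟨a₀, ha₀, h₀⟩ := h₀ Nbar Cin₁ C₀ CH
  obtain ⟨a₁, ha₁, h₁⟩ := h₁ Cin₂ C₀
  obtain ⟨C₃, a₃, ha₃, h₃⟩ := h₃ Cin₂ C₀
  obtain ⟨C₄, a₄, ha₄, h₄⟩ := h₄ Cin₂ C₀
  obtain ⟨C₅, a₅, ha₅, h₅⟩ := h₅ Cin₂ C₀
  refine ⟨max (C₃ + C₄) C₅, max (max a₀ (max a₁ a₂)) (max a₃ (max a₄ a₅)),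
    lt_max_of_lt_left (lt_max_of_lt_left ha₀), ?_⟩
  intro a ha ν hν hν1 T hT q
  obtain ⟨ha0, ha1, ha2, ha3, ha4, ha5⟩ := le_of_max6_le ha
  have ha_one : (1 : ℝ) ≤ a := ha₀.le.trans ha0
  let P : Params := ⟨β, α, a, b⟩
  have hτ : 0 < P.τ q := glueScale_pos ha_one q
  obtain ⟨cut⟩ := hcut T (P.τ q) hT hτ
  refine ⟨psiThree P T q 𝔚 cut.η, ?_⟩
  intro e he vbar pbar Rbar hNSR hsupp hsup hvel hstr htra hHol hgap
  -- ### move the trace of the stress into the pressure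
  set ptil : ℝ → 𝕋³ → ℝ := fun t x => pbar t x - (∑ i, Rbar t x i i) / 3 with hptil
  set Rtil : ℝ → 𝕋³ → Fin 3 → ℝ³ := fun t x => traceFreePart (Rbar t x) with hRtil
  have hNSR' : Torus.IsFracNSReynoldsOn (Icc 0 T) γ ν vbar ptil Rtil := hNSR.normaliseTrace
  have hX : ∀ (X : ℝ), 0 ≤ X → Cin * X ≤ Cin₁ * X := fun X hX => by
    refine mul_le_mul_of_nonneg_right ?_ hX
    rw [hCin₁]
    linarith [le_abs_self Cin, abs_nonneg Cin]
  have hX2 : ∀ (X : ℝ), 0 ≤ X → 2 * (Cin * X) ≤ Cin₁ * X := fun X hX => by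
    rw [hCin₁, mul_assoc]
    exact mul_le_mul_of_nonneg_left (mul_le_mul_of_nonneg_right (le_abs_self Cin) hX) zero_le_two
  have hℓ := mollScale_pos (β := β) (α := α) (b := b) ha_one q
  have hvel' : ∀ N : ℕ, N ≤ Nbar → HolderSupLE T vbar (N + 1) 0
      (Cin₁ * (Real.sqrt (amp β a b q) * freq a b q * mollScale β α a b q ^ (-(N : ℝ)))) :=
    fun N hN => (hvel N hN).mono (hX _ (mul_nonneg (mul_nonneg (Real.sqrt_nonneg _)
      (freq_pos ha_one q).le) (Real.rpow_nonneg hℓ.le _)))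
  have hstr' : ∀ N : ℕ, N ≤ Nbar → HolderSupLE T Rtil N (Real.toNNReal α)
      (Cin₁ * (amp β a b (q + 1) * mollScale β α a b q ^ (-(N : ℝ) + α))) :=
    fun N hN => (holderSupLE_traceFreePart hNSR.smooth_stress (hstr N hN)).mono
      (hX2 _ (mul_nonneg (amp_pos ha_one _).le (Real.rpow_nonneg hℓ.le _)))
  have htra' : ∀ N : ℕ, N ≤ Nbar → HolderSupLE T (advectiveDeriv T vbar Rtil) N (Real.toNNReal α)
      (Cin₁ * (amp β a b (q + 1) * Real.sqrt (amp β a b q) * freq a b q *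
        mollScale β α a b q ^ (-(N : ℝ) - α))) :=
    fun N hN => (holderSupLE_advectiveDeriv_traceFreePart hT hNSR.smooth_velocity hNSR.smooth_stress
      (htra N hN)).mono (hX2 _ (mul_nonneg (mul_nonneg (mul_nonneg (amp_pos ha_one _).le
        (Real.sqrt_nonneg _)) (freq_pos ha_one q).le) (Real.rpow_nonneg hℓ.le _)))
  let S : Setting := ⟨T, e, q, vbar, ptil, Rtil⟩
  have HN : NSRHypotheses P γ ν θ S Nbar Cin₁ C₀ CH :=
    ⟨hT, he, hNSR', fun t _ x => trace_traceFreePart (Rbar t x),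
      supportedOnGlueIntervals_traceFreePart hsupp, hsup, hvel', hstr', htra', hHol, hgap⟩
  have HC : CoreHypotheses P S Nbar Cin₂ C₀ := h₀ a ha0 ν hν hν1 S HN
  -- ### the construction data
  have hflow : ∀ i : ℕ, Nonempty (FlowDisplacement T vbar (min ((i : ℝ) * P.τ S.q) T)) :=
    fun i => backwardFlow_exists_holds T hT vbar hNSR.smooth_velocity _
      ⟨le_min (mul_nonneg i.cast_nonneg hτ.le) hT.le, min_le_right _ _⟩
  let 𝒟 : PerturbationData P S c₀ Cη := ⟨cut, fun i => Classical.choice (hflow i)⟩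
  refine ⟨newVelocity P S 𝔚 𝒟.cut.η 𝒟.D, newPressure P S 𝒟.cut.η, newStress P γ ν S 𝔚 𝒟.cut.η 𝒟.D,
    h₂ a ha2 γ hγ ν hν θ CH Nbar Cin₁ C₀ S HN 𝒟, ?_, ?_, ?_, ?_⟩
  · -- (5.19), Prop. 5.11
    have hinc := h₁ a ha1 S (HC.of_le ((le_max_left _ _).trans (le_max_left _ _))) 𝒟
    have hw : (fun t x => newVelocity P S 𝔚 𝒟.cut.η 𝒟.D t x - vbar t x) =
        BDSV.perturbation P S 𝔚 𝒟.cut.η 𝒟.D := by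
      funext t x
      simp [newVelocity, S]
    rw [hw]
    exact hinc
  · -- (5.20), Prop. 5.13: `‖R̊^E + R̊^D‖₀ ≤ (C₃ + C₄) scale`
    have hE := h₃ a ha3 S (HC.of_le ((le_max_right _ _).trans (le_max_left _ _))) 𝒟
    have hD := h₄ a ha4 ν hν hν1 S (HC.of_le ((le_max_left _ _).trans (le_max_right _ _))) 𝒟
    have hsum := hE.add hD
    rw [← add_mul] at hsum
    exact hsum.mono (mul_le_mul_of_nonneg_right (le_max_left _ _) (stressScale_nonneg ha_one q))
  · -- (5.21), Prop. 5.12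
    intro t ht
    have hent := h₅ a ha5 S (HC.of_le ((le_max_right _ _).trans (le_max_right _ _))) 𝒟 t ht
    exact hent.trans (mul_le_mul_of_nonneg_right (le_max_right _ _) (energyScale_nonneg ha_one q))
  · -- time zero
    have hη0 : ∀ i, i ≠ 0 → ∀ x, 𝒟.cut.η i 0 x = 0 := by
      intro i hi x
      by_contra hne
      have hs := (𝒟.cut.support i 0 x hne).1
      have hi1 : (1 : ℝ) ≤ i := by exact_mod_cast Nat.one_le_iff_ne_zero.2 hi
      have : (1 : ℝ) * P.τ S.q - P.τ S.q / 3 ≤ (i : ℝ) * P.τ S.q - P.τ S.q / 3 := by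
        gcongr
      nlinarith
    have hD0 : ∀ x, 𝒟.D 0 0 x = 0 := by
      intro x
      have h := (𝒟.flow 0).anchor x
      have hmin : min (((0 : ℕ) : ℝ) * P.τ S.q) S.T = 0 := by
        rw [Nat.cast_zero, zero_mul, min_eq_left hT.le]
      have e := congrArg (fun s : ℝ => (𝒟.flow 0).D s x) hmin
      exact e.symm.trans h
    have hR0 : ∀ x, S.Rbar 0 x = 0 := by
      intro x
      refine supportedOnGlueIntervals_traceFreePart hsupp 0 ⟨le_rfl, hT.le⟩ (fun n hn => ?_) x
      have h1 := hn.1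
      have h2 : (0 : ℝ) ≤ n * glueScale β α a b q := mul_nonneg n.cast_nonneg hτ.le
      have h3 : (0 : ℝ) < glueScale β α a b q := hτ
      linarith
    have hpot := potential_zero P S 𝔚 hη0 hD0 hR0
    funext x
    show vbar 0 x + ((P.freqNat (S.q + 1) : ℝ))⁻¹ • BDSV.curl (BDSV.potential P S 𝔚 𝒟.cut.η 𝒟.D 0) x = _
    rw [hpot]
    rfl

end Assembly

end DeRosa

end Literature.Analysis.FluidPDE
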